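import Literature.Probability.LatticeModels.PairIdentities
import HarnessLib

/-!
# s-holomorphicity of the critical FK-Ising observable (Smirnov 2010, Lemma 4.5): the discharge

Topic `Literature/Probability/LatticeModels`; ninth and final instalment of node 1 of the
discharge programme for crit-ising.S18. Main result:

* **`isSHolomorphic_fkIsingObservable_of_zdArcA_connected_of_planar`**: the two planar-topology
  named facts `medialCycle_separates` (T1, planar duality of the loop representation) and
  `medialCycle_turning` (T2, Hopf's Umlaufsatz for cycles of the turning rule) imply the
  corrected node-1 fact `isSHolomorphic_fkIsingObservable_of_zdArcA_connected`
  (`FKInterfacePairing.lean`): for admissible Dobrushin data whose wired arc is connected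
  through `Ω_δ`, `refPhase c₀ · F` is s-holomorphic on the interior medial vertices, `F` being
  H21's critical FK-Ising observable `fkIsingObservable D criticalFKIsingParam`.

The chain (all proved here, on top of the eight earlier instalments):
`pair_weighted` (the weighted pair identity `w(ω)X(ω) + w(ω ∪ e)X(ω ∪ e) = 0` in all cases
0/1/2 of Smirnov's table, with the FK ratio `√2` / `1/√2` decided by reachability:
`reachable_of_both_arrive` in case 2, T1 in case 1, transferred to the wired subtype graph of
`rcWeight` under (H1)) → `sum_weighted_arrivalSum` (`sum_powerset_pair`) →
`dartObs_add_dartObs_partner` / `dartObs_out` (arrivals resp. departures at an interior medial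
vertex add up to `κ F(e)`, `κ = (σ + σ̄)/2 = cos(π/8)`; `passageSum_cTgt`,
`fkIsingObservable_eq_sum`) → `projLine_cTgt` / `projLine_cSrc` (Lemma 4.1: `dartObs q` lies on
the line `quarterPhase (dartDir c₀ q) ℝ`, corners two faces apart carry orthogonal lines, so
`Proj[F(e); ℓ(r)] = κ⁻¹ dartObs r` for both medial vertices of the corner `r`) → the theorem
(`cornerLine = ± 2^{1/4} refPhase · quarterPhase (dartDir)`, `projLine_mul_mul`; degenerate
interior sites with no inner face are handled by `faces_dichotomy`: there `F` vanishes at both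
medial vertices).

What is NOT proved here: T1 and T2 themselves (named facts in `WeightTable.lean`), and the
hypothesis (H1) for the canonical discretisations `dobrushinData D δ` of crit-ising.S18.
-/

noncomputable section

namespace Literature.Probability.LatticeModels

open Finset SimpleGraph



/-! ### Small lemmas for the summation step -/

section Small

variable {D : DiscreteDobrushin} {ω ω' : Percolation.BondConfig (Site 2)} {c₀ p : Site 2 × Fin 4}

local notation "β" => D.bcBondConfig ω
local notation "β'" => D.bcBondConfig ω'

/-- **The two corners leaving a medial vertex**: `cSrc q = cTgt p` iff `q` is `(p.1, p.2 + 1)` (same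
vertex, next face) or `(p.1 + u_{k+1}, p.2 + 3)` (other endpoint). [folklore] -/
theorem cSrc_eq_cTgt_iff {q : Site 2 × Fin 4} :
    cSrc q = cTgt p ↔ q = (p.1, p.2 + 1) ∨ q = (p.1 + cornerUnit (p.2 + 1), p.2 + 3) := by
  rw [← cTgt_crossPred, cTgt_eq_cTgt_iff]
  obtain ⟨v, k⟩ := q
  obtain ⟨x, j⟩ := p
  simp only [cornerPartner, Prod.mk.injEq]
  constructor
  · rintro (⟨rfl, h⟩ | ⟨rfl, h⟩)
    · exact Or.inl ⟨rfl, by rw [← h]; omega⟩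
    · exact Or.inr ⟨rfl, by omega⟩
  · rintro (⟨rfl, rfl⟩ | ⟨rfl, rfl⟩)
    · exact Or.inl ⟨rfl, by omega⟩
    · exact Or.inr ⟨rfl, by omega⟩

/-- The arrival sum is symmetric in the two arriving corners. [cite: Smirnov2010, proof of Lemma 4.5] -/
theorem arrivalSum_partner (φ : ℤ → ℂ) (β₀ : Percolation.BondConfig (Site 2)) (c p₀ : Site 2 × Fin 4) (N₀ : ℕ) :
    arrivalSum φ β₀ c (cornerPartner p₀) N₀ = arrivalSum φ β₀ c p₀ N₀ := by
  unfold arrivalSum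
  refine Finset.sum_congr ?_ fun _ _ => rfl
  refine Finset.filter_congr fun j _ => ?_
  rw [partner_partner, or_comm]

/-- **Case 0 of the pairing**: if no dart of the exploration of `ω` arrives at `e`, neither does
any dart of the exploration of `ω ∪ e` (same orbit, `cornerOrbit_toggle_case0`), and both
arrival sums vanish. [cite: Smirnov2010, proof of Lemma 4.5] -/
theorem arrivalSum_case0 (hagree : ∀ e, e ≠ cTgt p → (e ∈ β' ↔ e ∈ β)) (hdiff : ¬ (cTgt p ∈ β' ↔ cTgt p ∈ β)) {N : ℕ}
    (h₁ : ∀ i < N, cornerOrbit β c₀ i ≠ p) (h₂ : ∀ i < N, cornerOrbit β c₀ i ≠ cornerPartner p) (φ : ℤ → ℂ) :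
    arrivalSum φ β c₀ p N = 0 ∧ arrivalSum φ β' c₀ p N = 0 := by
  have hcase := cornerOrbit_toggle_case0 hagree hdiff h₁ h₂
  constructor
  · refine Finset.sum_eq_zero fun j hj => ?_
    rw [Finset.mem_filter, Finset.mem_range] at hj
    rcases hj.2 with h | h
    · exact absurd h (h₁ j hj.1)
    · exact absurd h (h₂ j hj.1)
  · refine Finset.sum_eq_zero fun j hj => ?_
    rw [Finset.mem_filter, Finset.mem_range] at hj
    rw [hcase j hj.1.le] at hj
    rcases hj.2 with h | h
    · exact absurd h (h₁ j hj.1)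
    · exact absurd h (h₂ j hj.1)

/-- **The exit time is characterised** by: not inner at it, inner before it. [cite: Smirnov2001, §2] -/
theorem exitTime_eq_of (hD : D.IsZdAdmissible) (ω₀ : Percolation.BondConfig (Site 2)) {N' : ℕ}
    (hN' : ¬ D.IsInnerFace (cFace (cornerOrbit (D.bcBondConfig ω₀) (DiscreteDobrushin.startCorner hD) N')))
    (hlt' : ∀ k < N', D.IsInnerFace (cFace (cornerOrbit (D.bcBondConfig ω₀) (DiscreteDobrushin.startCorner hD) k))) :
    DiscreteDobrushin.exitTime hD ω₀ = N' := by
  classical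
  unfold DiscreteDobrushin.exitTime
  rw [Nat.find_eq_iff]
  exact ⟨hN', fun k hk => not_not.2 (hlt' k hk)⟩

/-- **Dichotomy at a non-boundary site**: either all four faces at `v` are inner, or none is —
two consecutive faces share a side, which would be a face-boundary edge if exactly one of them
were inner. [cite: Smirnov2001, §2] -/
theorem DiscreteDobrushin.faces_dichotomy (D : DiscreteDobrushin) {v : Site 2} (hv : v ∉ D.zdBoundary) :
    (∀ j, D.IsInnerFace (faceAt v j)) ∨ (∀ j, ¬ D.IsInnerFace (faceAt v j)) := by
  have hstep : ∀ j, D.IsInnerFace (faceAt v j) → D.IsInnerFace (faceAt v (j + 1)) := by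
    intro j hj
    by_contra hj1
    apply hv
    rw [mem_zdBoundary_iff]
    refine Or.inr ⟨v + cornerUnit (j + 1), adj_of_isInnerFace_faceAt hj (Or.inr (by omega)),
      ⟨faceAt v j, hj, isCorner_faceAt v j, (isCorner_add_faceAt_iff v (j + 1) j).2 (Or.inr (by omega))⟩,
      ⟨faceAt v (j + 1), hj1, isCorner_faceAt v (j + 1), (isCorner_add_faceAt_iff v (j + 1) (j + 1)).2 (Or.inl rfl)⟩⟩
  by_cases h0 : D.IsInnerFace (faceAt v 0)
  · left
    have h1 := hstep 0 h0
    have h2 := hstep _ h1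
    have h3 := hstep _ h2
    intro j
    fin_cases j
    · exact h0
    · exact h1
    · exact h2
    · exact h3
  · right
    intro j hj
    apply h0
    have h1 := hstep _ hj
    have h2 := hstep _ h1
    have h3 := hstep _ h2
    have h4 := hstep _ h3
    fin_cases j
    · exact hj
    · simpa using h3
    · simpa using h2
    · simpa using h1

end Small


/-! ### The weighted pair identity for one configuration `ω ∌ e` -/

section Weighted

variable {D : DiscreteDobrushin}

/-- Minimal periods exist for orbits through sites of `Ω_δ`. [cite: Smirnov2001, §2] -/
theorem exists_min_period (hD : D.IsZdAdmissible) (ω₀ : Percolation.BondConfig (Site 2)) {c : Site 2 × Fin 4}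
    (hc : c.1 ∈ meshDomain D.Ω D.δ) :
    ∃ P, 0 < P ∧ cornerOrbit (D.bcBondConfig ω₀) c P = c ∧ ∀ s, 0 < s → s < P → cornerOrbit (D.bcBondConfig ω₀) c s ≠ c := by
  classical
  have hex : ∃ P, 0 < P ∧ cornerOrbit (D.bcBondConfig ω₀) c P = c := exists_cornerOrbit_period hD hc
  refine ⟨Nat.find hex, (Nat.find_spec hex).1, (Nat.find_spec hex).2, fun s hs hsP h => ?_⟩
  exact Nat.find_min hex hsP ⟨hs, h⟩

/-- The loop through the partner of an arriving corner whose partner never arrives misses the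
interface cycle entirely (in particular it never passes through the arriving corner).
[cite: Smirnov2010, proof of Lemma 4.5] -/
theorem loop_ne_of_never_arrives (hD : D.IsZdAdmissible) {ω₀ : Percolation.BondConfig (Site 2)} {c₀ p : Site 2 × Fin 4}
    (hc₀ : D.IsStartCorner c₀) (hy : ∀ j, D.IsInnerFace (faceAt (p.1 + cornerUnit (p.2 + 1)) j))
    {N P : ℕ} (hN : ¬ D.IsInnerFace (cFace (cornerOrbit (D.bcBondConfig ω₀) c₀ N)))
    (hlt : ∀ k < N, D.IsInnerFace (cFace (cornerOrbit (D.bcBondConfig ω₀) c₀ k)))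
    (hP0 : 0 < P) (hP : cornerOrbit (D.bcBondConfig ω₀) c₀ P = c₀) (hPmin : ∀ s, 0 < s → s < P → cornerOrbit (D.bcBondConfig ω₀) c₀ s ≠ c₀)
    (h₂ : ∀ i < N, cornerOrbit (D.bcBondConfig ω₀) c₀ i ≠ cornerPartner p) (m s : ℕ) :
    cornerOrbit (D.bcBondConfig ω₀) (cornerPartner p) m ≠ cornerOrbit (D.bcBondConfig ω₀) c₀ s := by
  intro h
  obtain ⟨s', hs'⟩ := exists_eq_cornerOrbit_of_iterate hP0 hP m h
  have hin : D.IsInnerFace (cFace (cornerOrbit (D.bcBondConfig ω₀) c₀ s')) := hs' ▸ hy _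
  rw [isInnerFace_cornerOrbit_iff hD hc₀ hN hlt hP0 hP hPmin] at hin
  exact h₂ _ hin (by rw [cornerOrbit_mod_period hP]; exact hs'.symm)

/-- The completed configuration consists of lattice edges. [cite: Smirnov2001, §2] -/
theorem bcBondConfig_subset_zd (ω₀ : Percolation.BondConfig (Site 2)) : D.bcBondConfig ω₀ ⊆ (zdGraph 2).edgeSet := by
  intro e he
  have h := D.bcBondConfig_subset ω₀ he
  induction e using Sym2.ind with
  | h x y => exact meshGraph_le_zdGraph _ _ (discreteDomainGraph_le_meshGraph _ _ h)

/-- Edges of the interface graph are edges of `Ω_δ` avoiding the arc `B`. [cite: Smirnov2010, §2.1] -/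
theorem interfaceGraph_edge {e : Sym2 (meshDomain D.Ω D.δ)} (he : e ∈ D.interfaceGraph.edgeSet) :
    Sym2.map Subtype.val e ∈ (discreteDomainGraph D.Ω D.δ).edgeSet ∧ ∀ x ∈ Sym2.map Subtype.val e, x ∉ D.zdArcB := by
  induction e using Sym2.ind with
  | h u v =>
    rw [DiscreteDobrushin.interfaceGraph, SimpleGraph.mem_edgeSet, SimpleGraph.deleteEdges_adj] at he
    obtain ⟨hadj, hB⟩ := he
    refine ⟨?_, fun x hx => ?_⟩
    · rw [Sym2.map_mk]; exact hadj
    · rw [Sym2.map_mk] at hx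
      intro hxB
      apply hB
      rcases Sym2.mem_iff.1 hx with rfl | rfl
      · exact ⟨u, Sym2.mem_mk_left _ _, hxB⟩
      · exact ⟨v, Sym2.mem_mk_right _ _, hxB⟩

/-- An edge of `Ω_δ` avoiding the arc `B` is an edge of the interface graph. [cite: Smirnov2010, §2.1] -/
theorem mem_interfaceGraph_edgeFinset [Fintype (meshDomain D.Ω D.δ)] [DecidableRel D.interfaceGraph.Adj]
    {u v : meshDomain D.Ω D.δ}
    (hadj : (discreteDomainGraph D.Ω D.δ).Adj u.val v.val) (hu : u.val ∉ D.zdArcB) (hv : v.val ∉ D.zdArcB) :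
    s(u, v) ∈ D.interfaceGraph.edgeFinset := by
  rw [SimpleGraph.mem_edgeFinset, SimpleGraph.mem_edgeSet, DiscreteDobrushin.interfaceGraph, SimpleGraph.deleteEdges_adj]
  refine ⟨hadj, ?_⟩
  rintro ⟨x, hx, hxB⟩
  rcases Sym2.mem_iff.1 hx with rfl | rfl
  · exact hu hxB
  · exact hv hxB

open scoped Classical in
/-- **The weighted pair identity.** For admissible data with connected wired arc (H1), the two
planar facts T1, T2, an interior medial vertex `e = cTgt p` all of whose endpoints' faces are
inner, a summand factor `φ` satisfying both table identities, and a configuration `ω ∌ e` of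
the interface graph: `w(ω) · X(ω) + w(ω ∪ e) · X(ω ∪ e) = 0`, where `X` is the arrival sum of
the exploration (from the start corner, up to the exit time) and `w` the critical FK weight
wired on `A`. Cases 0/1/2 of Smirnov's table, with the FK weight ratio `√2` resp. `1/√2`
decided by whether the endpoints of `e` are joined (`rcWeight_insert_critical`; case 2: joined
along the exploration; case 1: separated by the partner's loop, T1).
[cite: Smirnov2010, proof of Lemma 4.5] -/
theorem pair_weighted (hD : D.IsZdAdmissible) [Fintype (meshDomain D.Ω D.δ)]
    (hA : ((discreteDomainGraph D.Ω D.δ).induce D.zdArcA).Preconnected)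
    (hT1 : medialCycle_separates) (hT2 : medialCycle_turning) {p : Site 2 × Fin 4}
    (hx : ∀ j, D.IsInnerFace (faceAt p.1 j)) (hy : ∀ j, D.IsInnerFace (faceAt (p.1 + cornerUnit (p.2 + 1)) j))
    (φ : ℤ → ℂ) (hφ1 : ∀ a : ℂ, (Real.sqrt 2 : ℂ) * (a * φ 1) + (a * φ (-1) + a * eighthPhase 4 * φ (-1)) = 0)
    (hφ2 : ∀ a : ℂ, a * φ 1 + a * eighthPhase (-4) * φ 1 + (Real.sqrt 2 : ℂ) * (a * φ (-1)) = 0)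
    {u v : meshDomain D.Ω D.δ} (hu : u.val = p.1) (hv : v.val = p.1 + cornerUnit (p.2 + 1))
    (heG : s(u, v) ∈ D.interfaceGraph.edgeFinset) (hpA : ¬ (p.1 ∈ D.zdArcA ∧ p.1 + cornerUnit (p.2 + 1) ∈ D.zdArcA))
    {ω : Finset (Sym2 (meshDomain D.Ω D.δ))} (hω : ω ⊆ D.interfaceGraph.edgeFinset) (heω : s(u, v) ∉ ω) :
    (rcWeight D.interfaceGraph criticalFKIsingParam 2 (Subtype.val ⁻¹' D.zdArcA) ω : ℂ) *
        arrivalSum φ (D.bcBondConfig (liftConfig D.Ω D.δ ω)) (DiscreteDobrushin.startCorner hD) p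
          (DiscreteDobrushin.exitTime hD (liftConfig D.Ω D.δ ω)) +
      (rcWeight D.interfaceGraph criticalFKIsingParam 2 (Subtype.val ⁻¹' D.zdArcA) (insert s(u, v) ω) : ℂ) *
        arrivalSum φ (D.bcBondConfig (liftConfig D.Ω D.δ (insert s(u, v) ω))) (DiscreteDobrushin.startCorner hD) p
          (DiscreteDobrushin.exitTime hD (liftConfig D.Ω D.δ (insert s(u, v) ω))) = 0 := by
  -- notation and basic data
  set c₀ := DiscreteDobrushin.startCorner hD with hc₀def
  have hc₀ : D.IsStartCorner c₀ := DiscreteDobrushin.isStartCorner_startCorner hD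
  set β := D.bcBondConfig (liftConfig D.Ω D.δ ω) with hβ
  set β' := D.bcBondConfig (liftConfig D.Ω D.δ (insert s(u, v) ω)) with hβ'
  set N := DiscreteDobrushin.exitTime hD (liftConfig D.Ω D.δ ω) with hNdef
  have hN : ¬ D.IsInnerFace (cFace (cornerOrbit β c₀ N)) := DiscreteDobrushin.not_isInnerFace_exitTime hD _
  have hlt : ∀ k < N, D.IsInnerFace (cFace (cornerOrbit β c₀ k)) := fun k hk =>
    DiscreteDobrushin.isInnerFace_of_lt_exitTime hD _ hk
  have hpe : cTgt p = Sym2.map Subtype.val s(u, v) := by rw [Sym2.map_mk, hu, hv]; rfl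
  have heG' := interfaceGraph_edge (D := D) (SimpleGraph.mem_edgeFinset.1 heG)
  have hpA' : ¬ ∀ x ∈ Sym2.map Subtype.val s(u, v), x ∈ D.zdArcA := by
    intro h; rw [← hpe] at h
    exact hpA ⟨h _ (Sym2.mem_mk_left _ _), h _ (Sym2.mem_mk_right _ _)⟩
  obtain ⟨hagree, hdiff⟩ := DiscreteDobrushin.toggle_hypotheses heG'.1 heG'.2 hpA' heω hpe
  have he : cTgt p ∉ β := by rw [hpe]; exact DiscreteDobrushin.map_not_mem_bcBondConfig_liftConfig heω hpA'
  have hωE : ∀ e ∈ ω, Sym2.map Subtype.val e ∈ (discreteDomainGraph D.Ω D.δ).edgeSet ∧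
      ∀ x ∈ Sym2.map Subtype.val e, x ∉ D.zdArcB := fun e he => interfaceGraph_edge (SimpleGraph.mem_edgeFinset.1 (hω he))
  -- the FK weight of `ω ∪ e`
  have hW := rcWeight_insert_critical (G := D.interfaceGraph) (Subtype.val ⁻¹' D.zdArcA) heG heω
  set w := rcWeight D.interfaceGraph criticalFKIsingParam 2 (Subtype.val ⁻¹' D.zdArcA) ω with hwdef
  have hs2 : (Real.sqrt 2 : ℂ) * (Real.sqrt 2 : ℂ) = 2 := by
    rw [← Complex.ofReal_mul, Real.mul_self_sqrt zero_le_two]; norm_num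
  -- wired reachability of the endpoints = reachability in the completed configuration ((H1))
  have hreach_iff : (Percolation.openGraph (↑ω : Percolation.BondConfig (meshDomain D.Ω D.δ)) ⊔
      wired (Subtype.val ⁻¹' D.zdArcA)).Reachable u v ↔ (Percolation.openGraph β).Reachable p.1 (p.1 + cornerUnit (p.2 + 1)) := by
    constructor
    · intro h
      have := DiscreteDobrushin.reachable_bc_of_reachable_wired hA hωE h
      rwa [hu, hv] at this
    · intro h
      have h' : (Percolation.openGraph β).Reachable u.val v.val := by rwa [hu, hv]
      exact DiscreteDobrushin.reachable_wired_of_reachable_bc u.2 v.2 h'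
  -- symmetric versions of the toggling hypotheses (for the partner)
  have hagree2 : ∀ e, e ≠ cTgt (cornerPartner p) → (e ∈ β' ↔ e ∈ β) := by rw [cTgt_partner]; exact hagree
  have hdiff2 : ¬ (cTgt (cornerPartner p) ∈ β' ↔ cTgt (cornerPartner p) ∈ β) := by rw [cTgt_partner]; exact hdiff
  have he2 : cTgt (cornerPartner p) ∉ β := by rw [cTgt_partner]; exact he
  have hpp : ∀ i j, cornerOrbit β c₀ i = p → cornerOrbit β c₀ j = cornerPartner p → i ≠ j := by
    rintro i j hi hj rfl; exact partner_ne p (hj.symm.trans hi)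
  by_cases h₁ : ∃ i, i < N ∧ cornerOrbit β c₀ i = p
  · by_cases h₂ : ∃ i, i < N ∧ cornerOrbit β c₀ i = cornerPartner p
    · -- case 2: both corners arrive; the endpoints are joined, weight ratio `√2`
      obtain ⟨i₁, hi₁N, hi₁⟩ := h₁
      obtain ⟨i₂, hi₂N, hi₂⟩ := h₂
      have hR := hreach_iff.2 (reachable_of_both_arrive β c₀ hi₁ hi₂)
      rw [if_pos hR] at hW
      rcases Nat.lt_or_gt_of_ne (hpp i₁ i₂ hi₁ hi₂) with h12 | h12
      · have hX := arrivalSum_case2 hD hc₀ hagree hdiff he hT2 hlt hi₁ hi₂ h12 hi₂N φ hφ2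
        have hex := exit_toggle_case2 hD hc₀ hagree hdiff hN hlt hi₁ hi₂ h12 hi₂N
        rw [exitTime_eq_of hD _ hex.1 hex.2, hW]
        push_cast
        linear_combination (w : ℂ) * hX
      · have hX := arrivalSum_case2 (p := cornerPartner p) hD hc₀ hagree2 hdiff2 he2 hT2 hlt hi₂
          (by rw [partner_partner]; exact hi₁) h12 hi₁N φ hφ2
        rw [arrivalSum_partner, arrivalSum_partner] at hX
        have hex := exit_toggle_case2 (p := cornerPartner p) hD hc₀ hagree2 hdiff2 hN hlt hi₂
          (by rw [partner_partner]; exact hi₁) h12 hi₁N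
        rw [exitTime_eq_of hD _ hex.1 hex.2, hW]
        push_cast
        linear_combination (w : ℂ) * hX
    · -- case 1 for `p`: its partner never arrives; the endpoints are separated (T1), ratio `1/√2`
      obtain ⟨i₁, hi₁N, hi₁⟩ := h₁
      have h₂' : ∀ i < N, cornerOrbit β c₀ i ≠ cornerPartner p := fun i hi h => h₂ ⟨i, hi, h⟩
      have hc₀m : c₀.1 ∈ meshDomain D.Ω D.δ := D.zdBoundary_subset_meshDomain (D.zdArcA_subset_zdBoundary hc₀.mem_zdArcA)
      obtain ⟨P, hP0, hP, hPmin⟩ := exists_min_period hD (liftConfig D.Ω D.δ ω) hc₀m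
      have hym : (cornerPartner p).1 ∈ meshDomain D.Ω D.δ := by
        change p.1 + cornerUnit (p.2 + 1) ∈ _; rw [← hv]; exact v.2
      obtain ⟨Q, hQ0, hQ, hQmin⟩ := exists_min_period hD (liftConfig D.Ω D.δ ω) hym
      have hX := arrivalSum_case1 hD hc₀ hagree hdiff he hT2 hx hy hN hlt hP0 hP hPmin hQ0 hQ hQmin hi₁ hi₁N h₂' φ hφ1
      have hL : ∀ m, cornerOrbit β (cornerPartner p) m ≠ p := fun m h =>
        loop_ne_of_never_arrives hD hc₀ hy hN hlt hP0 hP hPmin h₂' m i₁ (h.trans hi₁.symm)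
      have hnR : ¬ (Percolation.openGraph β).Reachable p.1 (p.1 + cornerUnit (p.2 + 1)) :=
        hT1 β (bcBondConfig_subset_zd _) p he Q hQ0 hQ hL
      rw [if_neg (fun h => hnR (hreach_iff.1 h))] at hW
      obtain ⟨-, -, -, hin', hout'⟩ := cornerOrbit_toggle_case1 hD hc₀ hagree hdiff hx hy hN hlt hP0 hP hPmin hQ0 hQ
        hQmin hi₁ hi₁N h₂'
      rw [exitTime_eq_of hD _ hout' hin', hW]
      push_cast
      linear_combination ((w : ℂ) * Real.sqrt 2 / 2) * hX -
        ((w : ℂ) * arrivalSum φ β c₀ p N / 2) * hs2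
  · have h₁' : ∀ i < N, cornerOrbit β c₀ i ≠ p := fun i hi h => h₁ ⟨i, hi, h⟩
    by_cases h₂ : ∃ i, i < N ∧ cornerOrbit β c₀ i = cornerPartner p
    · -- case 1 for the partner
      obtain ⟨i₂, hi₂N, hi₂⟩ := h₂
      have hc₀m : c₀.1 ∈ meshDomain D.Ω D.δ := D.zdBoundary_subset_meshDomain (D.zdArcA_subset_zdBoundary hc₀.mem_zdArcA)
      obtain ⟨P, hP0, hP, hPmin⟩ := exists_min_period hD (liftConfig D.Ω D.δ ω) hc₀m
      have hxm : (cornerPartner (cornerPartner p)).1 ∈ meshDomain D.Ω D.δ := by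
        rw [partner_partner, ← hu]; exact u.2
      obtain ⟨Q, hQ0, hQ, hQmin⟩ := exists_min_period hD (liftConfig D.Ω D.δ ω) hxm
      have hyx : (cornerPartner p).1 + cornerUnit ((cornerPartner p).2 + 1) = p.1 := by
        change p.1 + cornerUnit (p.2 + 1) + cornerUnit (p.2 + 2 + 1) = p.1
        rw [show p.2 + 2 + 1 = (p.2 + 1) + 2 by omega, cornerUnit_add_two]; abel
      have hx' : ∀ j, D.IsInnerFace (faceAt (cornerPartner p).1 j) := hy
      have hy' : ∀ j, D.IsInnerFace (faceAt ((cornerPartner p).1 + cornerUnit ((cornerPartner p).2 + 1)) j) := by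
        rw [hyx]; exact hx
      have h₁'' : ∀ i < N, cornerOrbit β c₀ i ≠ cornerPartner (cornerPartner p) := by
        rw [partner_partner]; exact h₁'
      have hX := arrivalSum_case1 (p := cornerPartner p) hD hc₀ hagree2 hdiff2 he2 hT2 hx' hy' hN hlt hP0 hP hPmin hQ0 hQ
        hQmin hi₂ hi₂N h₁'' φ hφ1
      rw [arrivalSum_partner, arrivalSum_partner] at hX
      have hL : ∀ m, cornerOrbit β (cornerPartner (cornerPartner p)) m ≠ cornerPartner p := fun m h =>
        loop_ne_of_never_arrives (p := cornerPartner p) hD hc₀ hy' hN hlt hP0 hP hPmin h₁'' m i₂ (h.trans hi₂.symm)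
      have hnR' := hT1 β (bcBondConfig_subset_zd _) (cornerPartner p) he2 Q hQ0 hQ hL
      rw [hyx] at hnR'
      have hnR : ¬ (Percolation.openGraph β).Reachable p.1 (p.1 + cornerUnit (p.2 + 1)) := fun h => hnR' h.symm
      rw [if_neg (fun h => hnR (hreach_iff.1 h))] at hW
      obtain ⟨-, -, -, hin', hout'⟩ := cornerOrbit_toggle_case1 (p := cornerPartner p) hD hc₀ hagree2 hdiff2 hx' hy' hN hlt
        hP0 hP hPmin hQ0 hQ hQmin hi₂ hi₂N h₁''
      rw [exitTime_eq_of hD _ hout' hin', hW]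
      push_cast
      linear_combination ((w : ℂ) * Real.sqrt 2 / 2) * hX -
        ((w : ℂ) * arrivalSum φ β c₀ p N / 2) * hs2
    · -- case 0: no arrival at all
      have h₂' : ∀ i < N, cornerOrbit β c₀ i ≠ cornerPartner p := fun i hi h => h₂ ⟨i, hi, h⟩
      obtain ⟨h0, h0'⟩ := arrivalSum_case0 (c₀ := c₀) hagree hdiff h₁' h₂' φ
      have hcase := cornerOrbit_toggle_case0 (c₀ := c₀) hagree hdiff h₁' h₂'
      have hN' : DiscreteDobrushin.exitTime hD (liftConfig D.Ω D.δ (insert s(u, v) ω)) = N := by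
        refine exitTime_eq_of hD _ ?_ fun k hk => ?_
        · rw [hcase N le_rfl]; exact hN
        · rw [hcase k hk.le]; exact hlt k hk
      rw [hN', h0, h0']
      ring

end Weighted


/-! ### Summation over pairs -/

section Summation

variable {D : DiscreteDobrushin}

open scoped Classical in
/-- **Summing the pair identities** (`sum_powerset_pair` at the edge `e`): the weighted arrival
sums over all configurations of the interface graph add up to zero.
[cite: Smirnov2010, proof of Lemma 4.5] -/
theorem sum_weighted_arrivalSum (hD : D.IsZdAdmissible) [Fintype (meshDomain D.Ω D.δ)]
    (hA : ((discreteDomainGraph D.Ω D.δ).induce D.zdArcA).Preconnected)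
    (hT1 : medialCycle_separates) (hT2 : medialCycle_turning) {p : Site 2 × Fin 4}
    (hx : ∀ j, D.IsInnerFace (faceAt p.1 j)) (hy : ∀ j, D.IsInnerFace (faceAt (p.1 + cornerUnit (p.2 + 1)) j))
    (φ : ℤ → ℂ) (hφ1 : ∀ a : ℂ, (Real.sqrt 2 : ℂ) * (a * φ 1) + (a * φ (-1) + a * eighthPhase 4 * φ (-1)) = 0)
    (hφ2 : ∀ a : ℂ, a * φ 1 + a * eighthPhase (-4) * φ 1 + (Real.sqrt 2 : ℂ) * (a * φ (-1)) = 0)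
    {u v : meshDomain D.Ω D.δ} (hu : u.val = p.1) (hv : v.val = p.1 + cornerUnit (p.2 + 1))
    (heG : s(u, v) ∈ D.interfaceGraph.edgeFinset) (hpA : ¬ (p.1 ∈ D.zdArcA ∧ p.1 + cornerUnit (p.2 + 1) ∈ D.zdArcA)) :
    ∑ ω ∈ D.interfaceGraph.edgeFinset.powerset,
      (rcWeight D.interfaceGraph criticalFKIsingParam 2 (Subtype.val ⁻¹' D.zdArcA) ω : ℂ) *
        arrivalSum φ (D.bcBondConfig (liftConfig D.Ω D.δ ω)) (DiscreteDobrushin.startCorner hD) p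
          (DiscreteDobrushin.exitTime hD (liftConfig D.Ω D.δ ω)) = 0 := by
  rw [sum_powerset_pair heG]
  refine Finset.sum_eq_zero fun ω hω => ?_
  rw [Finset.mem_powerset] at hω
  have hωE : ω ⊆ D.interfaceGraph.edgeFinset := hω.trans (Finset.erase_subset _ _)
  have heω : s(u, v) ∉ ω := fun h => Finset.notMem_erase _ _ (hω h)
  exact pair_weighted hD hA hT1 hT2 hx hy φ hφ1 hφ2 hu hv heG hpA hωE heω

end Summation


/-! ### From arrival sums to the observables -/

section Observables

variable {D : DiscreteDobrushin}

open scoped Classical in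
/-- The **dart observable** at the coded corner `q`: the expectation of the spin-`½` weights
`quarterPhase (turnCount j) = e^{-iπ C_j/4}` of the darts of the exploration carried by `q`
(Smirnov's edge observable `F(c)` at the "corner point" of `q`, eq. (4.1) with (2.2)).
[cite: Smirnov2010, §4 eq. (4.1)] -/
def dartObs (D : DiscreteDobrushin) [Fintype (meshDomain D.Ω D.δ)] (hD : D.IsZdAdmissible) (q : Site 2 × Fin 4) : ℂ :=
  ∑ ω ∈ D.interfaceGraph.edgeFinset.powerset,
    ((rcWeight D.interfaceGraph criticalFKIsingParam 2 (Subtype.val ⁻¹' D.zdArcA) ω /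
        rcPartitionFunction D.interfaceGraph criticalFKIsingParam 2 (Subtype.val ⁻¹' D.zdArcA) : ℝ) : ℂ) *
      ∑ j ∈ (Finset.range (DiscreteDobrushin.exitTime hD (liftConfig D.Ω D.δ ω))).filter
          (fun j => cornerOrbit (D.bcBondConfig (liftConfig D.Ω D.δ ω)) (DiscreteDobrushin.startCorner hD) j = q),
        quarterPhase (turnCount (D.bcBondConfig (liftConfig D.Ω D.δ ω)) (DiscreteDobrushin.startCorner hD) j)

open scoped Classical in
/-- The arrival sum with `φ s = 1 - κ E(s)`, per configuration: darts at `p` plus darts at the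
partner minus `κ` times the passages through `e = cTgt p`. [cite: Smirnov2010, proof of Lemma 4.5] -/
theorem arrivalSum_in_eq (hD : D.IsZdAdmissible) {ω₀ : Percolation.BondConfig (Site 2)} {p : Site 2 × Fin 4}
    (hB : ∀ x ∈ cTgt p, x ∉ D.zdArcB) :
    arrivalSum (fun s => 1 - kappa * eighthPhase s) (D.bcBondConfig ω₀) (DiscreteDobrushin.startCorner hD) p
        (DiscreteDobrushin.exitTime hD ω₀) =
      (∑ j ∈ (Finset.range (DiscreteDobrushin.exitTime hD ω₀)).filter
          (fun j => cornerOrbit (D.bcBondConfig ω₀) (DiscreteDobrushin.startCorner hD) j = p),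
        quarterPhase (turnCount (D.bcBondConfig ω₀) (DiscreteDobrushin.startCorner hD) j)) +
      (∑ j ∈ (Finset.range (DiscreteDobrushin.exitTime hD ω₀)).filter
          (fun j => cornerOrbit (D.bcBondConfig ω₀) (DiscreteDobrushin.startCorner hD) j = cornerPartner p),
        quarterPhase (turnCount (D.bcBondConfig ω₀) (DiscreteDobrushin.startCorner hD) j)) -
      kappa * passageSum (explorationList (D.bcBondConfig ω₀) (DiscreteDobrushin.startCorner hD)
        (DiscreteDobrushin.exitTime hD ω₀)) D.δ (1 / 2) (cTgt p) := by
  rw [passageSum_cTgt hD (DiscreteDobrushin.isStartCorner_startCorner hD) (DiscreteDobrushin.not_isInnerFace_exitTime hD _)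
    (fun k hk => DiscreteDobrushin.isInnerFace_of_lt_exitTime hD _ hk) hB, arrivalSum]
  have h1 : (∑ j ∈ (Finset.range (DiscreteDobrushin.exitTime hD ω₀)).filter
      (fun j => cornerOrbit (D.bcBondConfig ω₀) (DiscreteDobrushin.startCorner hD) j = p ∨
        cornerOrbit (D.bcBondConfig ω₀) (DiscreteDobrushin.startCorner hD) j = cornerPartner p),
      quarterPhase (turnCount (D.bcBondConfig ω₀) (DiscreteDobrushin.startCorner hD) j)) =
      (∑ j ∈ (Finset.range (DiscreteDobrushin.exitTime hD ω₀)).filter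
          (fun j => cornerOrbit (D.bcBondConfig ω₀) (DiscreteDobrushin.startCorner hD) j = p),
        quarterPhase (turnCount (D.bcBondConfig ω₀) (DiscreteDobrushin.startCorner hD) j)) +
      (∑ j ∈ (Finset.range (DiscreteDobrushin.exitTime hD ω₀)).filter
          (fun j => cornerOrbit (D.bcBondConfig ω₀) (DiscreteDobrushin.startCorner hD) j = cornerPartner p),
        quarterPhase (turnCount (D.bcBondConfig ω₀) (DiscreteDobrushin.startCorner hD) j)) := by
    rw [Finset.filter_or, Finset.sum_union]
    rw [Finset.disjoint_filter]
    intro j _ h h'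
    exact partner_ne p (h'.symm.trans h)
  rw [← h1, Finset.mul_sum, ← Finset.sum_sub_distrib]
  refine Finset.sum_congr rfl fun j _ => ?_
  rw [quarterPhase_eq_eighthPhase, eighthPhase_add]; ring

open scoped Classical in
/-- **The incoming identity** (Smirnov 2010, proof of Lemma 4.5, "`p_v(N)+p_v(S) = F(W)`" in
complexified form): the dart observables of the two corners arriving at the interior medial vertex
`e` add up to `κ` times H21's vertex observable at `e`, `κ = cos(π/8)`.
[cite: Smirnov2010, proof of Lemma 4.5] -/
theorem dartObs_add_dartObs_partner (hD : D.IsZdAdmissible) [Fintype (meshDomain D.Ω D.δ)]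
    (hA : ((discreteDomainGraph D.Ω D.δ).induce D.zdArcA).Preconnected)
    (hT1 : medialCycle_separates) (hT2 : medialCycle_turning) {p : Site 2 × Fin 4}
    (hx : ∀ j, D.IsInnerFace (faceAt p.1 j)) (hy : ∀ j, D.IsInnerFace (faceAt (p.1 + cornerUnit (p.2 + 1)) j))
    {u v : meshDomain D.Ω D.δ} (hu : u.val = p.1) (hv : v.val = p.1 + cornerUnit (p.2 + 1))
    (heG : s(u, v) ∈ D.interfaceGraph.edgeFinset) (hpA : ¬ (p.1 ∈ D.zdArcA ∧ p.1 + cornerUnit (p.2 + 1) ∈ D.zdArcA))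
    (hB : ∀ x ∈ cTgt p, x ∉ D.zdArcB) :
    dartObs D hD p + dartObs D hD (cornerPartner p) = kappa * fkIsingObservable D criticalFKIsingParam (cTgt p) := by
  have hS := sum_weighted_arrivalSum hD hA hT1 hT2 hx hy (fun s => 1 - kappa * eighthPhase s)
    (fun a => table_case1 a) (fun a => table_case2 a) hu hv heG hpA
  simp only [arrivalSum_in_eq hD hB] at hS
  have hZ := rcPartitionFunction_pos D.interfaceGraph criticalFKIsingParam_mem_Icc two_pos (Subtype.val ⁻¹' D.zdArcA)
  rw [fkIsingObservable_eq_sum hD, dartObs, dartObs, ← Finset.sum_add_distrib, Finset.mul_sum]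
  rw [← sub_eq_zero, ← Finset.sum_sub_distrib]
  set Z := rcPartitionFunction D.interfaceGraph criticalFKIsingParam 2 (Subtype.val ⁻¹' D.zdArcA) with hZdef
  calc _ = (Z : ℂ)⁻¹ * ∑ ω ∈ D.interfaceGraph.edgeFinset.powerset,
        (rcWeight D.interfaceGraph criticalFKIsingParam 2 (Subtype.val ⁻¹' D.zdArcA) ω : ℂ) *
          ((∑ j ∈ (Finset.range (DiscreteDobrushin.exitTime hD (liftConfig D.Ω D.δ ω))).filter
              (fun j => cornerOrbit (D.bcBondConfig (liftConfig D.Ω D.δ ω)) (DiscreteDobrushin.startCorner hD) j = p),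
            quarterPhase (turnCount (D.bcBondConfig (liftConfig D.Ω D.δ ω)) (DiscreteDobrushin.startCorner hD) j)) +
          (∑ j ∈ (Finset.range (DiscreteDobrushin.exitTime hD (liftConfig D.Ω D.δ ω))).filter
              (fun j => cornerOrbit (D.bcBondConfig (liftConfig D.Ω D.δ ω)) (DiscreteDobrushin.startCorner hD) j = cornerPartner p),
            quarterPhase (turnCount (D.bcBondConfig (liftConfig D.Ω D.δ ω)) (DiscreteDobrushin.startCorner hD) j)) -
          kappa * passageSum (explorationList (D.bcBondConfig (liftConfig D.Ω D.δ ω)) (DiscreteDobrushin.startCorner hD)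
            (DiscreteDobrushin.exitTime hD (liftConfig D.Ω D.δ ω))) D.δ (1 / 2) (cTgt p)) := by
          rw [Finset.mul_sum]
          refine Finset.sum_congr rfl fun ω _ => ?_
          rw [Complex.real_smul]
          push_cast
          have hZ' : (Z : ℂ) ≠ 0 := by exact_mod_cast hZ.ne'
          field_simp
    _ = 0 := by rw [hS, mul_zero]

open scoped Classical in
/-- The arrival sum with `φ s = E(2s) - κ E(s)`, per configuration: departing darts at the two
corners leaving `e` minus `κ` times the passages through `e`. [cite: Smirnov2010, proof of Lemma 4.5] -/
theorem arrivalSum_out_eq (hD : D.IsZdAdmissible) {ω₀ : Percolation.BondConfig (Site 2)} {p : Site 2 × Fin 4}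
    (hB : ∀ x ∈ cTgt p, x ∉ D.zdArcB) :
    arrivalSum (fun s => eighthPhase (2 * s) - kappa * eighthPhase s) (D.bcBondConfig ω₀) (DiscreteDobrushin.startCorner hD) p
        (DiscreteDobrushin.exitTime hD ω₀) =
      (∑ j ∈ (Finset.range (DiscreteDobrushin.exitTime hD ω₀)).filter
          (fun j => cornerOrbit (D.bcBondConfig ω₀) (DiscreteDobrushin.startCorner hD) j = (p.1, p.2 + 1)),
        quarterPhase (turnCount (D.bcBondConfig ω₀) (DiscreteDobrushin.startCorner hD) j)) +
      (∑ j ∈ (Finset.range (DiscreteDobrushin.exitTime hD ω₀)).filter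
          (fun j => cornerOrbit (D.bcBondConfig ω₀) (DiscreteDobrushin.startCorner hD) j =
            (p.1 + cornerUnit (p.2 + 1), p.2 + 3)),
        quarterPhase (turnCount (D.bcBondConfig ω₀) (DiscreteDobrushin.startCorner hD) j)) -
      kappa * passageSum (explorationList (D.bcBondConfig ω₀) (DiscreteDobrushin.startCorner hD)
        (DiscreteDobrushin.exitTime hD ω₀)) D.δ (1 / 2) (cTgt p) := by
  set c₀ := DiscreteDobrushin.startCorner hD
  set β₀ := D.bcBondConfig ω₀
  set N := DiscreteDobrushin.exitTime hD ω₀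
  have hc₀ : D.IsStartCorner c₀ := DiscreteDobrushin.isStartCorner_startCorner hD
  have hN : ¬ D.IsInnerFace (cFace (cornerOrbit β₀ c₀ N)) := DiscreteDobrushin.not_isInnerFace_exitTime hD _
  have hlt : ∀ k < N, D.IsInnerFace (cFace (cornerOrbit β₀ c₀ k)) := fun k hk =>
    DiscreteDobrushin.isInnerFace_of_lt_exitTime hD _ hk
  rw [passageSum_cTgt hD hc₀ hN hlt hB, arrivalSum]
  -- departures: reindex `k = j + 1`
  have hlast : cSrc (cornerOrbit β₀ c₀ N) ≠ cTgt p := fun h => by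
    obtain ⟨M, hM⟩ : ∃ M, N = M + 1 := ⟨N - 1, (Nat.succ_pred_eq_of_pos (DiscreteDobrushin.exitTime_pos hD ω₀)).symm⟩
    rw [hM, cSrc_cornerOrbit_succ] at h
    have hMlt : M < N := by omega
    obtain ⟨-, -, hBe, -⟩ := cornerOrbit_exit hD hc₀ (hlt M hMlt) (by rw [hM] at hN; exact hN)
    exact hB _ (h ▸ Sym2.mem_mk_right _ _) hBe
  have h0 : cSrc (cornerOrbit β₀ c₀ 0) ≠ cTgt p := fun h => by
    rw [cornerOrbit_zero] at h
    exact hB _ (h ▸ Sym2.mem_mk_right _ _) hc₀.mem_zdArcB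
  have hfilter : (Finset.range N).filter (fun k => cornerOrbit β₀ c₀ k = (p.1, p.2 + 1) ∨
      cornerOrbit β₀ c₀ k = (p.1 + cornerUnit (p.2 + 1), p.2 + 3)) =
      ((Finset.range N).filter (fun j => cornerOrbit β₀ c₀ j = p ∨ cornerOrbit β₀ c₀ j = cornerPartner p)).image (· + 1) := by
    ext k
    simp only [Finset.mem_filter, Finset.mem_range, Finset.mem_image]
    constructor
    · rintro ⟨hk, hke⟩
      rw [← cSrc_eq_cTgt_iff] at hke
      obtain ⟨j, rfl⟩ : ∃ j, k = j + 1 := ⟨k - 1, by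
        rcases k with _ | k
        · exact absurd hke h0
        · simp⟩
      refine ⟨j, ⟨by omega, ?_⟩, rfl⟩
      rw [cSrc_cornerOrbit_succ] at hke
      exact cTgt_eq_cTgt_iff.1 hke
    · rintro ⟨j, ⟨hj, hjp⟩, rfl⟩
      have hke : cSrc (cornerOrbit β₀ c₀ (j + 1)) = cTgt p := by
        rw [cSrc_cornerOrbit_succ]; exact cTgt_eq_cTgt_iff.2 hjp
      refine ⟨?_, cSrc_eq_cTgt_iff.1 hke⟩
      rcases Nat.lt_or_ge (j + 1) N with h | h
      · exact h
      · exfalso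
        have : j + 1 = N := by omega
        rw [this] at hke
        exact hlast hke
  have h1 : (∑ j ∈ (Finset.range N).filter (fun j => cornerOrbit β₀ c₀ j = p ∨ cornerOrbit β₀ c₀ j = cornerPartner p),
      quarterPhase (turnCount β₀ c₀ (j + 1))) =
      (∑ j ∈ (Finset.range N).filter (fun j => cornerOrbit β₀ c₀ j = (p.1, p.2 + 1)),
        quarterPhase (turnCount β₀ c₀ j)) +
      (∑ j ∈ (Finset.range N).filter (fun j => cornerOrbit β₀ c₀ j = (p.1 + cornerUnit (p.2 + 1), p.2 + 3)),
        quarterPhase (turnCount β₀ c₀ j)) := by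
    rw [← Finset.sum_union, ← Finset.filter_or, hfilter, Finset.sum_image (fun _ _ _ _ h => Nat.succ_injective h)]
    rw [Finset.disjoint_filter]
    rintro j - h h'
    rw [h] at h'
    have := congrArg Prod.snd h'
    simp at this
  rw [← h1, Finset.mul_sum, ← Finset.sum_sub_distrib]
  refine Finset.sum_congr rfl fun j _ => ?_
  rw [turnCount_succ, quarterPhase_eq_eighthPhase, mul_add, eighthPhase_add, eighthPhase_add]
  ring

open scoped Classical in
/-- **The outgoing identity** (Smirnov 2010, proof of Lemma 4.5, "`p_v(E)+p_v(W) = F(W)`"):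
the dart observables of the two corners leaving the interior medial vertex `e = cTgt p` add up to
`κ` times the vertex observable at `e`. [cite: Smirnov2010, proof of Lemma 4.5] -/
theorem dartObs_out (hD : D.IsZdAdmissible) [Fintype (meshDomain D.Ω D.δ)]
    (hA : ((discreteDomainGraph D.Ω D.δ).induce D.zdArcA).Preconnected)
    (hT1 : medialCycle_separates) (hT2 : medialCycle_turning) {p : Site 2 × Fin 4}
    (hx : ∀ j, D.IsInnerFace (faceAt p.1 j)) (hy : ∀ j, D.IsInnerFace (faceAt (p.1 + cornerUnit (p.2 + 1)) j))
    {u v : meshDomain D.Ω D.δ} (hu : u.val = p.1) (hv : v.val = p.1 + cornerUnit (p.2 + 1))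
    (heG : s(u, v) ∈ D.interfaceGraph.edgeFinset) (hpA : ¬ (p.1 ∈ D.zdArcA ∧ p.1 + cornerUnit (p.2 + 1) ∈ D.zdArcA))
    (hB : ∀ x ∈ cTgt p, x ∉ D.zdArcB) :
    dartObs D hD (p.1, p.2 + 1) + dartObs D hD (p.1 + cornerUnit (p.2 + 1), p.2 + 3) =
      kappa * fkIsingObservable D criticalFKIsingParam (cTgt p) := by
  have hφ1 : ∀ a : ℂ, (Real.sqrt 2 : ℂ) * (a * (fun s : ℤ => eighthPhase (2 * s) - kappa * eighthPhase s) 1) +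
      (a * (fun s : ℤ => eighthPhase (2 * s) - kappa * eighthPhase s) (-1) +
        a * eighthPhase 4 * (fun s : ℤ => eighthPhase (2 * s) - kappa * eighthPhase s) (-1)) = 0 := by
    intro a; simpa using table_case1_out a
  have hφ2 : ∀ a : ℂ, a * (fun s : ℤ => eighthPhase (2 * s) - kappa * eighthPhase s) 1 +
      a * eighthPhase (-4) * (fun s : ℤ => eighthPhase (2 * s) - kappa * eighthPhase s) 1 +
        (Real.sqrt 2 : ℂ) * (a * (fun s : ℤ => eighthPhase (2 * s) - kappa * eighthPhase s) (-1)) = 0 := by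
    intro a; simpa using table_case2_out a
  have hS := sum_weighted_arrivalSum hD hA hT1 hT2 hx hy (fun s => eighthPhase (2 * s) - kappa * eighthPhase s)
    hφ1 hφ2 hu hv heG hpA
  simp only [arrivalSum_out_eq hD hB] at hS
  have hZ := rcPartitionFunction_pos D.interfaceGraph criticalFKIsingParam_mem_Icc two_pos (Subtype.val ⁻¹' D.zdArcA)
  rw [fkIsingObservable_eq_sum hD, dartObs, dartObs, ← Finset.sum_add_distrib, Finset.mul_sum]
  rw [← sub_eq_zero, ← Finset.sum_sub_distrib]
  set Z := rcPartitionFunction D.interfaceGraph criticalFKIsingParam 2 (Subtype.val ⁻¹' D.zdArcA) with hZdef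
  calc _ = (Z : ℂ)⁻¹ * ∑ ω ∈ D.interfaceGraph.edgeFinset.powerset,
        (rcWeight D.interfaceGraph criticalFKIsingParam 2 (Subtype.val ⁻¹' D.zdArcA) ω : ℂ) *
          ((∑ j ∈ (Finset.range (DiscreteDobrushin.exitTime hD (liftConfig D.Ω D.δ ω))).filter
              (fun j => cornerOrbit (D.bcBondConfig (liftConfig D.Ω D.δ ω)) (DiscreteDobrushin.startCorner hD) j = (p.1, p.2 + 1)),
            quarterPhase (turnCount (D.bcBondConfig (liftConfig D.Ω D.δ ω)) (DiscreteDobrushin.startCorner hD) j)) +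
          (∑ j ∈ (Finset.range (DiscreteDobrushin.exitTime hD (liftConfig D.Ω D.δ ω))).filter
              (fun j => cornerOrbit (D.bcBondConfig (liftConfig D.Ω D.δ ω)) (DiscreteDobrushin.startCorner hD) j =
                (p.1 + cornerUnit (p.2 + 1), p.2 + 3)),
            quarterPhase (turnCount (D.bcBondConfig (liftConfig D.Ω D.δ ω)) (DiscreteDobrushin.startCorner hD) j)) -
          kappa * passageSum (explorationList (D.bcBondConfig (liftConfig D.Ω D.δ ω)) (DiscreteDobrushin.startCorner hD)
            (DiscreteDobrushin.exitTime hD (liftConfig D.Ω D.δ ω))) D.δ (1 / 2) (cTgt p)) := by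
          rw [Finset.mul_sum]
          refine Finset.sum_congr rfl fun ω _ => ?_
          rw [Complex.real_smul]
          push_cast
          have hZ' : (Z : ℂ) ≠ 0 := by exact_mod_cast hZ.ne'
          field_simp
    _ = 0 := by rw [hS, mul_zero]

end Observables


/-! ### Lines and projections -/

section Lines

variable {D : DiscreteDobrushin}

open Complex

/-- Sums of real multiples of `η` are real multiples of `η`. [folklore] -/
theorem exists_real_sum {ι : Type*} (s : Finset ι) (f : ι → ℂ) (η : ℂ)
    (h : ∀ i ∈ s, ∃ t : ℝ, f i = t * η) : ∃ t : ℝ, ∑ i ∈ s, f i = t * η := by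
  classical
  induction s using Finset.induction_on with
  | empty => exact ⟨0, by simp⟩
  | insert a s ha ih =>
    obtain ⟨t, ht⟩ := ih fun i hi => h i (Finset.mem_insert_of_mem hi)
    obtain ⟨t', ht'⟩ := h a (Finset.mem_insert_self _ _)
    exact ⟨t' + t, by rw [Finset.sum_insert ha, ht, ht']; push_cast; ring⟩

/-- **Lemma 4.1 for the dart observable**: `dartObs q` lies on the line of `q`'s direction,
`quarterPhase (dartDir c₀ q) · ℝ`. [cite: Smirnov2010, Lemma 4.1] -/
theorem dartObs_mem_line (hD : D.IsZdAdmissible) [Fintype (meshDomain D.Ω D.δ)] (q : Site 2 × Fin 4) :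
    ∃ t : ℝ, dartObs D hD q = t * quarterPhase (dartDir (DiscreteDobrushin.startCorner hD) q) := by
  classical
  unfold dartObs
  refine exists_real_sum _ _ _ fun ω _ => ?_
  obtain ⟨t, ht⟩ := exists_real_sum _ _ (quarterPhase (dartDir (DiscreteDobrushin.startCorner hD) q)) (fun j hj => by
    rw [Finset.mem_filter] at hj
    refine ⟨(-1) ^ (turnCount (D.bcBondConfig (liftConfig D.Ω D.δ ω)) (DiscreteDobrushin.startCorner hD) j / 4).natAbs, ?_⟩
    rw [quarterPhase_turnCount, hj.2]; push_cast; rfl :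
    ∀ j ∈ (Finset.range (DiscreteDobrushin.exitTime hD (liftConfig D.Ω D.δ ω))).filter
        (fun j => cornerOrbit (D.bcBondConfig (liftConfig D.Ω D.δ ω)) (DiscreteDobrushin.startCorner hD) j = q),
      ∃ t : ℝ, quarterPhase (turnCount (D.bcBondConfig (liftConfig D.Ω D.δ ω)) (DiscreteDobrushin.startCorner hD) j) =
        t * quarterPhase (dartDir (DiscreteDobrushin.startCorner hD) q))
  refine ⟨rcWeight D.interfaceGraph criticalFKIsingParam 2 (Subtype.val ⁻¹' D.zdArcA) ω /
      rcPartitionFunction D.interfaceGraph criticalFKIsingParam 2 (Subtype.val ⁻¹' D.zdArcA) * t, ?_⟩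
  rw [ht]; push_cast; ring

/-- Projections are additive. [cite: ChelkakSmirnov2012, §3.2] -/
theorem projLine_add (η F G : ℂ) : projLine η (F + G) = projLine η F + projLine η G := by
  rw [projLine_eq, projLine_eq, projLine_eq, ← add_smul, add_mul, add_re, add_div]

/-- `projLine η 0 = 0`. [cite: ChelkakSmirnov2012, §3.2] -/
theorem projLine_zero (η : ℂ) : projLine η 0 = 0 := by
  rw [projLine_eq]; simp

/-- Real scalars pass through the projection. [cite: ChelkakSmirnov2012, §3.2] -/
theorem projLine_real_mul_right (η : ℂ) (t : ℝ) (F : ℂ) : projLine η (t * F) = t * projLine η F := by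
  rw [projLine_eq, projLine_eq, mul_assoc, re_ofReal_mul, mul_div_assoc, Complex.real_smul, Complex.real_smul]
  push_cast; ring

/-- A vector on the line projects to itself. [cite: ChelkakSmirnov2012, §3.2] -/
theorem projLine_real_mul_self {η : ℂ} (hη : η ≠ 0) (t : ℝ) : projLine η (t * η) = t * η := by
  rw [projLine_eq, mul_assoc, re_ofReal_mul, mul_conj', ← ofReal_pow, ofReal_re, Complex.real_smul]
  have : ‖η‖ ^ 2 ≠ 0 := pow_ne_zero _ (norm_ne_zero_iff.2 hη)
  have h' : (‖η‖ : ℂ) ≠ 0 := by exact_mod_cast norm_ne_zero_iff.2 hη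
  push_cast
  field_simp

/-- A vector on the orthogonal line `i η ℝ` projects to zero. [cite: ChelkakSmirnov2012, §3.2] -/
theorem projLine_I_mul_self (η : ℂ) (t : ℝ) : projLine η (t * (I * η)) = 0 := by
  rw [projLine_eq, show ↑t * (I * η) * (starRingEnd ℂ) η = (t * I) * (η * (starRingEnd ℂ) η) by ring, mul_conj',
    ← ofReal_pow]
  have : (↑t * I * ((‖η‖ ^ 2 : ℝ) : ℂ)).re = 0 := by
    rw [show (t : ℂ) * I * ((‖η‖ ^ 2 : ℝ) : ℂ) = ((t * ‖η‖ ^ 2 : ℝ) : ℂ) * I by push_cast; ring, mul_I_re, ofReal_im,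
      neg_zero]
  rw [this]; simp

/-- `quarterPhase` is additive-to-multiplicative. [cite: Smirnov2010, §4] -/
theorem quarterPhase_add (a b : ℤ) : quarterPhase (a + b) = quarterPhase a * quarterPhase b := by
  rw [quarterPhase, quarterPhase, quarterPhase, ← exp_add]; congr 1; push_cast; ring

/-- `quarterPhase 2 = -I`, `quarterPhase (-2) = I`. [cite: Smirnov2010, §4] -/
theorem quarterPhase_two : quarterPhase 2 = -I ∧ quarterPhase (-2) = I := by
  have h2 : quarterPhase (-2) = I := by
    rw [quarterPhase, show -(Real.pi / 4 * ((-2 : ℤ) : ℂ)) * I = Real.pi / 2 * I by push_cast; ring, exp_pi_div_two_mul_I]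
  refine ⟨?_, h2⟩
  have h := quarterPhase_add 2 (-2)
  rw [show (2 : ℤ) + -2 = 0 by norm_num, h2] at h
  have h0 : quarterPhase 0 = 1 := by simp [quarterPhase]
  rw [h0] at h
  have : quarterPhase 2 = I⁻¹ := eq_inv_of_mul_eq_one_left h.symm
  rw [this, inv_I]

/-- **Corners two faces apart carry orthogonal lines**: if `q'.2 = q.2 + 2` then
`quarterPhase (dartDir c₀ q') = ± I · quarterPhase (dartDir c₀ q)`. [cite: Smirnov2010, Lemma 4.1] -/
theorem quarterPhase_dartDir_add_two (c₀ q q' : Site 2 × Fin 4) (h : q'.2 = q.2 + 2) :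
    quarterPhase (dartDir c₀ q') = I * quarterPhase (dartDir c₀ q) ∨
      quarterPhase (dartDir c₀ q') = -(I * quarterPhase (dartDir c₀ q)) := by
  unfold dartDir
  rw [h]
  have key : ((q.2 + 2 - c₀.2 : Fin 4) : ℕ) = ((q.2 - c₀.2 : Fin 4) : ℕ) + 2 ∨
      ((q.2 + 2 - c₀.2 : Fin 4) : ℕ) + 2 = ((q.2 - c₀.2 : Fin 4) : ℕ) := by
    have : q.2 + 2 - c₀.2 = (q.2 - c₀.2) + 2 := by abel
    rw [this]
    generalize q.2 - c₀.2 = d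
    fin_cases d <;> decide
  rcases key with key | key
  · right
    rw [key, Nat.cast_add, Nat.cast_two, quarterPhase_add, quarterPhase_two.1]; ring
  · left
    have : ((q.2 - c₀.2 : Fin 4) : ℕ) = ((q.2 + 2 - c₀.2 : Fin 4) : ℕ) + 2 := key.symm
    rw [this, Nat.cast_add, Nat.cast_two, quarterPhase_add, quarterPhase_two.1]
    rw [show I * (quarterPhase _ * -I) = quarterPhase ((q.2 + 2 - c₀.2 : Fin 4) : ℕ) * (-(I * I)) by ring, I_mul_I]; ring

/-- `κ` is real: `κ = Re σ`. [cite: Smirnov2010, §4] -/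
theorem kappa_eq_re : kappa = ((eighthPhase 1).re : ℂ) := by
  rw [kappa, Complex.re_eq_add_conj, eighthPhase, eighthPhase, ← exp_conj]
  congr 2
  rw [show -(Real.pi / 8 * ((1 : ℤ) : ℂ)) * I = ((-(Real.pi / 8) : ℝ) : ℂ) * I by push_cast; ring,
    show -(Real.pi / 8 * ((-1 : ℤ) : ℂ)) * I = -(((-(Real.pi / 8) : ℝ) : ℂ) * I) by push_cast; ring,
    map_mul, conj_ofReal, conj_I]
  ring

/-- `κ ≠ 0` (`κ = cos (π/8) > 0`). [cite: Smirnov2010, §4] -/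
theorem kappa_ne_zero : kappa ≠ 0 := by
  rw [kappa_eq_re, eighthPhase, show -(Real.pi / 8 * ((1 : ℤ) : ℂ)) * I = ((-(Real.pi / 8) : ℝ) : ℂ) * I by push_cast; ring,
    exp_ofReal_mul_I_re]
  have : 0 < Real.cos (-(Real.pi / 8)) := Real.cos_pos_of_mem_Ioo ⟨by linarith [Real.pi_pos], by linarith [Real.pi_pos]⟩
  exact_mod_cast this.ne'

end Lines


/-! ### The final assembly: s-holomorphicity of `refPhase c₀ · F` -/

section Final

variable {D : DiscreteDobrushin}

open Complex

/-- **No passage without an inner face**: if neither corner arriving at `e = cTgt p` has an inner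
face, the observable vanishes at `e` (darts of the exploration have inner faces). [cite: Smirnov2010, §2.2] -/
theorem fkIsingObservable_eq_zero_of_not_inner (hD : D.IsZdAdmissible) [Fintype (meshDomain D.Ω D.δ)] {p : Site 2 × Fin 4}
    (hB : ∀ x ∈ cTgt p, x ∉ D.zdArcB) (h1 : ¬ D.IsInnerFace (cFace p)) (h2 : ¬ D.IsInnerFace (cFace (cornerPartner p))) :
    fkIsingObservable D criticalFKIsingParam (cTgt p) = 0 := by
  rw [fkIsingObservable_eq_sum hD]
  refine Finset.sum_eq_zero fun ω _ => ?_
  rw [passageSum_cTgt hD (DiscreteDobrushin.isStartCorner_startCorner hD) (DiscreteDobrushin.not_isInnerFace_exitTime hD _)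
    (fun k hk => DiscreteDobrushin.isInnerFace_of_lt_exitTime hD _ hk) hB, Finset.sum_eq_zero, smul_zero]
  intro j hj
  rw [Finset.mem_filter, Finset.mem_range] at hj
  have hin := DiscreteDobrushin.isInnerFace_of_lt_exitTime hD (liftConfig D.Ω D.δ ω) hj.1
  rcases hj.2 with h | h
  · exact absurd (h ▸ hin) h1
  · exact absurd (h ▸ hin) h2

open scoped Classical in
/-- The data needed at an interior edge `e = cTgt p` all of whose endpoint faces are inner:
the subtype endpoints and the side conditions of `dartObs_add_dartObs_partner` / `dartObs_out`.
[cite: Smirnov2010, §4] -/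
theorem interior_data [Fintype (meshDomain D.Ω D.δ)] {p : Site 2 × Fin 4}
    (he : cTgt p ∈ D.innerMedialVertices) :
    ∃ u v : meshDomain D.Ω D.δ, u.val = p.1 ∧ v.val = p.1 + cornerUnit (p.2 + 1) ∧
      s(u, v) ∈ D.interfaceGraph.edgeFinset ∧ ¬ (p.1 ∈ D.zdArcA ∧ p.1 + cornerUnit (p.2 + 1) ∈ D.zdArcA) ∧
      (∀ x ∈ cTgt p, x ∉ D.zdArcB) := by
  classical
  rw [DiscreteDobrushin.mem_innerMedialVertices_iff] at he
  obtain ⟨hedge, harc⟩ := he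
  have hadj : (discreteDomainGraph D.Ω D.δ).Adj p.1 (p.1 + cornerUnit (p.2 + 1)) := hedge
  refine ⟨⟨p.1, mem_meshDomain_of_mem_edge hedge (Sym2.mem_mk_left _ _)⟩,
    ⟨p.1 + cornerUnit (p.2 + 1), mem_meshDomain_of_mem_edge hedge (Sym2.mem_mk_right _ _)⟩, rfl, rfl,
    mem_interfaceGraph_edgeFinset hadj (harc _ (Sym2.mem_mk_left _ _)).2 (harc _ (Sym2.mem_mk_right _ _)).2,
    fun h => (harc _ (Sym2.mem_mk_left _ _)).1 h.1, fun x hx => (harc x hx).2⟩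

/-- At an interior medial vertex of admissible data, a site off the arcs is off the discrete
boundary. [cite: Smirnov2001, §2] -/
theorem not_mem_zdBoundary_of_mem_inner (hD : D.IsZdAdmissible) {e : MedialVertex} (he : e ∈ D.innerMedialVertices)
    {x : Site 2} (hx : x ∈ e) : x ∉ D.zdBoundary := by
  intro h
  rcases hD.zdBoundary_subset h with h | h
  · exact (he.2 x hx).1 h
  · exact (he.2 x hx).2 h

/-- **Projection identity at the target**: for an interior `e = cTgt p` with all faces at both
endpoints inner, `Proj[F(e); ℓ(p)] = κ⁻¹ · dartObs p` (`ℓ(p) = quarterPhase (dartDir c₀ p) ℝ`).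
[cite: Smirnov2010, proof of Lemma 4.5] -/
theorem projLine_cTgt (hD : D.IsZdAdmissible) [Fintype (meshDomain D.Ω D.δ)]
    (hA : ((discreteDomainGraph D.Ω D.δ).induce D.zdArcA).Preconnected)
    (hT1 : medialCycle_separates) (hT2 : medialCycle_turning) {p : Site 2 × Fin 4}
    (hx : ∀ j, D.IsInnerFace (faceAt p.1 j)) (hy : ∀ j, D.IsInnerFace (faceAt (p.1 + cornerUnit (p.2 + 1)) j))
    (he : cTgt p ∈ D.innerMedialVertices) :
    projLine (quarterPhase (dartDir (DiscreteDobrushin.startCorner hD) p)) (fkIsingObservable D criticalFKIsingParam (cTgt p)) =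
      (((eighthPhase 1).re)⁻¹ : ℝ) * dartObs D hD p := by
  obtain ⟨u, v, hu, hv, heG, hpA, hB⟩ := interior_data he
  have hk := dartObs_add_dartObs_partner hD hA hT1 hT2 hx hy hu hv heG hpA hB
  have hkr : ((eighthPhase 1).re : ℝ) ≠ 0 := by
    have := kappa_ne_zero; rw [kappa_eq_re] at this; exact_mod_cast this
  have hF : fkIsingObservable D criticalFKIsingParam (cTgt p) =
      (((eighthPhase 1).re)⁻¹ : ℝ) * (dartObs D hD p + dartObs D hD (cornerPartner p)) := by
    rw [hk, kappa_eq_re, ← mul_assoc]; push_cast; rw [inv_mul_cancel₀ (by exact_mod_cast hkr), one_mul]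
  obtain ⟨t, ht⟩ := dartObs_mem_line hD p
  obtain ⟨t', ht'⟩ := dartObs_mem_line hD (cornerPartner p)
  have hη : quarterPhase (dartDir (DiscreteDobrushin.startCorner hD) p) ≠ 0 :=
    norm_ne_zero_iff.1 (by rw [norm_quarterPhase]; exact one_ne_zero)
  rw [hF, projLine_real_mul_right, projLine_add, ht, projLine_real_mul_self hη, ht']
  rcases quarterPhase_dartDir_add_two (DiscreteDobrushin.startCorner hD) p (cornerPartner p) rfl with h | h
  · rw [h, projLine_I_mul_self, add_zero]
  · rw [h, show (t' : ℂ) * -(I * quarterPhase (dartDir (DiscreteDobrushin.startCorner hD) p)) =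
      ((-t' : ℝ) : ℂ) * (I * quarterPhase (dartDir (DiscreteDobrushin.startCorner hD) p)) by push_cast; ring,
      projLine_I_mul_self, add_zero]

/-- **Projection identity at the source**: for `e' = cSrc r` with all faces at both endpoints
inner, `Proj[F(e'); ℓ(r)] = κ⁻¹ · dartObs r`. [cite: Smirnov2010, proof of Lemma 4.5] -/
theorem projLine_cSrc (hD : D.IsZdAdmissible) [Fintype (meshDomain D.Ω D.δ)]
    (hA : ((discreteDomainGraph D.Ω D.δ).induce D.zdArcA).Preconnected)
    (hT1 : medialCycle_separates) (hT2 : medialCycle_turning) {r : Site 2 × Fin 4}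
    (hx : ∀ j, D.IsInnerFace (faceAt r.1 j)) (hy : ∀ j, D.IsInnerFace (faceAt (r.1 + cornerUnit r.2) j))
    (he : cSrc r ∈ D.innerMedialVertices) :
    projLine (quarterPhase (dartDir (DiscreteDobrushin.startCorner hD) r)) (fkIsingObservable D criticalFKIsingParam (cSrc r)) =
      (((eighthPhase 1).re)⁻¹ : ℝ) * dartObs D hD r := by
  have hrot : cTgt (r.1, r.2 + 3) = cSrc r := cTgt_crossPred r
  rw [← hrot] at he ⊢
  obtain ⟨u, v, hu, hv, heG, hpA, hB⟩ := interior_data he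
  have h31 : r.2 + 3 + 1 = r.2 := by omega
  have hy' : ∀ j, D.IsInnerFace (faceAt (r.1 + cornerUnit (r.2 + 3 + 1)) j) := by
    rw [h31]; exact hy
  have hk := dartObs_out hD hA hT1 hT2 (p := (r.1, r.2 + 3)) hx hy' hu hv heG hpA hB
  have hr : ((r.1, r.2 + 3 + 1) : Site 2 × Fin 4) = r := Prod.ext rfl h31
  simp only [hr] at hk
  have hkr : ((eighthPhase 1).re : ℝ) ≠ 0 := by
    have := kappa_ne_zero; rw [kappa_eq_re] at this; exact_mod_cast this
  set r' : Site 2 × Fin 4 := (r.1 + cornerUnit (r.2 + 3 + 1), r.2 + 3 + 3) with hr'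
  have hF : fkIsingObservable D criticalFKIsingParam (cTgt (r.1, r.2 + 3)) =
      (((eighthPhase 1).re)⁻¹ : ℝ) * (dartObs D hD r + dartObs D hD r') := by
    rw [hk, kappa_eq_re, ← mul_assoc]; push_cast; rw [inv_mul_cancel₀ (by exact_mod_cast hkr), one_mul]
  obtain ⟨t, ht⟩ := dartObs_mem_line hD r
  obtain ⟨t', ht'⟩ := dartObs_mem_line hD r'
  have hη : quarterPhase (dartDir (DiscreteDobrushin.startCorner hD) r) ≠ 0 :=
    norm_ne_zero_iff.1 (by rw [norm_quarterPhase]; exact one_ne_zero)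
  rw [hF, projLine_real_mul_right, projLine_add, ht, projLine_real_mul_self hη, ht']
  rcases quarterPhase_dartDir_add_two (DiscreteDobrushin.startCorner hD) r r' (by rw [hr']; simp only; omega) with h | h
  · rw [h, projLine_I_mul_self, add_zero]
  · rw [h, show (t' : ℂ) * -(I * quarterPhase (dartDir (DiscreteDobrushin.startCorner hD) r)) =
      ((-t' : ℝ) : ℂ) * (I * quarterPhase (dartDir (DiscreteDobrushin.startCorner hD) r)) by push_cast; ring,
      projLine_I_mul_self, add_zero]

/-- **Node 1 of crit-ising.S18, conditional discharge.** Given the two planar-topology facts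
`medialCycle_separates` (T1) and `medialCycle_turning` (T2), the corrected s-holomorphicity
fact `isSHolomorphic_fkIsingObservable_of_zdArcA_connected` holds: for admissible data whose
wired arc is connected through `Ω_δ`, `refPhase c₀ · F` is s-holomorphic on the interior medial
vertices (Smirnov 2010, Lemma 4.5 with Remark 4.7, in H21's conventions; the constant
`refPhase c₀` turns the dart lines into H21's `cornerLine`s, `cornerLine_eq_or_eq_neg`).
[cite: Smirnov2010, Lemma 4.5] -/
theorem isSHolomorphic_fkIsingObservable_of_zdArcA_connected_of_planar
    (hT1 : medialCycle_separates) (hT2 : medialCycle_turning) :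
    isSHolomorphic_fkIsingObservable_of_zdArcA_connected := by
  intro D hD _ hA
  set c₀ := DiscreteDobrushin.startCorner hD with hc₀
  refine ⟨refPhase c₀, refPhase_ne_zero c₀, ?_⟩
  intro v f hcorner hsrc htgt
  obtain ⟨k, rfl⟩ := exists_faceAt_of_isCorner hcorner
  -- the coded corner `r = (v, k)`: `cornerSource = cSrc r`, `cornerTarget = cTgt r`
  have hs : cornerSource v (faceAt v k) = cSrc (v, k) := cornerSource_faceAt v k
  have ht : cornerTarget v (faceAt v k) = cTgt (v, k) := cornerTarget_faceAt v k
  rw [hs] at hsrc ⊢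
  rw [ht] at htgt ⊢
  have hvb : v ∉ D.zdBoundary := not_mem_zdBoundary_of_mem_inner hD hsrc (Sym2.mem_mk_left _ _)
  -- the line of `cornerLine` is that of `refPhase c₀ · quarterPhase (dartDir c₀ r)`
  have hline : ∀ G : ℂ, projLine (cornerLine v (faceAt v k)) (refPhase c₀ * G) =
      refPhase c₀ * projLine (quarterPhase (dartDir c₀ (v, k))) G := by
    intro G
    have hsq : Real.sqrt (Real.sqrt 2) ≠ 0 := (Real.sqrt_pos.2 (Real.sqrt_pos.2 two_pos)).ne'
    rcases cornerLine_eq_or_eq_neg c₀ (v, k) with h | h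
    · rw [show cornerLine v (faceAt v k) = cornerLine (v, k).1 (cFace (v, k)) from rfl, h, projLine_real_mul hsq,
        projLine_mul_mul (refPhase_ne_zero c₀)]
    · rw [show cornerLine v (faceAt v k) = cornerLine (v, k).1 (cFace (v, k)) from rfl, h, projLine_neg,
        projLine_real_mul hsq, projLine_mul_mul (refPhase_ne_zero c₀)]
  rw [hline, hline]
  congr 1
  rcases D.faces_dichotomy hvb with hin | hout
  · -- all faces at `v` inner: both projections equal `κ⁻¹ dartObs r`
    have hyT : ∀ j, D.IsInnerFace (faceAt (v + cornerUnit (k + 1)) j) := by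
      have hyb : v + cornerUnit (k + 1) ∉ D.zdBoundary := not_mem_zdBoundary_of_mem_inner hD htgt (Sym2.mem_mk_right _ _)
      rcases D.faces_dichotomy hyb with h | h
      · exact h
      · exact absurd (by rw [faceAt_add_unit_succ]; exact hin (k + 1)) (h (k + 1 + 1))
    have hyS : ∀ j, D.IsInnerFace (faceAt (v + cornerUnit k) j) := by
      have hyb : v + cornerUnit k ∉ D.zdBoundary := not_mem_zdBoundary_of_mem_inner hD hsrc (Sym2.mem_mk_right _ _)
      rcases D.faces_dichotomy hyb with h | h
      · exact h
      · exact absurd (by rw [faceAt_add_unit_succ]; exact hin k) (h (k + 1))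
    rw [projLine_cSrc hD hA hT1 hT2 hin hyS hsrc, projLine_cTgt hD hA hT1 hT2 hin hyT htgt]
  · -- no face at `v` inner: both values vanish
    have hB1 : ∀ x ∈ cTgt (v, k), x ∉ D.zdArcB := fun x hx => (htgt.2 x hx).2
    have hB0 : ∀ x ∈ cTgt ((v, k + 3) : Site 2 × Fin 4), x ∉ D.zdArcB := by
      rw [cTgt_crossPred (v, k)]; exact fun x hx => (hsrc.2 x hx).2
    have h1 : fkIsingObservable D criticalFKIsingParam (cTgt (v, k)) = 0 := by
      refine fkIsingObservable_eq_zero_of_not_inner hD hB1 (hout k) ?_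
      change ¬ D.IsInnerFace (faceAt (v + cornerUnit (k + 1)) (k + 2))
      rw [show k + 2 = (k + 1) + 1 by omega, faceAt_add_unit_succ]; exact hout _
    have h0 : fkIsingObservable D criticalFKIsingParam (cSrc (v, k)) = 0 := by
      rw [← cTgt_crossPred (v, k)]
      refine fkIsingObservable_eq_zero_of_not_inner hD hB0 (hout (k + 3)) ?_
      change ¬ D.IsInnerFace (faceAt (v + cornerUnit (k + 3 + 1)) (k + 3 + 2))
      rw [show k + 3 + 2 = (k + 3 + 1) + 1 by omega, faceAt_add_unit_succ]; exact hout _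
    rw [h0, h1]

end Final

end Literature.Probability.LatticeModels
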